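import Summits.CriticalPhenomena.Ising3DConformalLimit.Theorems.EnergyNotSigmaSquaredGapForcesFarMergingScreeningDefs
import Literature.Probability.LatticeModels.SourcedDoubleCurrentsSwitchingProofs
import Literature.Probability.LatticeModels.GKSInequalities
import Mathlib.MeasureTheory.Integral.Bochner.SumMeasure

/-! # The one-pinch screening ladder at the root: pointwise bounds and the series form
(line `screening-form-lemma-a1` of crux `GapForcesFarMerging`, item stmt-CriticalPhenomena-4468;
helper file of stub `stub_rootOpacity`, ROOT FLOOR, the screening side)

`pinchScreen n r m = 𝔼^{0 up,∅}_{Λ_n}[𝟙[e₂, dn ∉ C(0)] S_{e₂ dn}(C_r(0))]` is a series over pairs of box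
currents weighted by the double-current probabilities (`meanScreening_eq_tsum`; the box law is a
finitely supported push-forward). On the event that every bond at the escape ray
`R = {(0,1,t) : 0 ≤ t ≤ r}` is closed and `dn m ∉ C(0)`, the explored cluster `C_r(0)` misses `R`, so
by Griffiths' antitonicity of the screening ratio in the obstacle the integrand is at least the
deterministic ratio `S_{e₂ dn}(Λ_r ∖ R) ≥ η₁(r)` (`screening_le_screenWeight`, `screening_root_lower`);
elsewhere it is nonnegative. Hence `pinchScreen n r m ≥ S_{e₂ dn}(Λ_r∖R) · P[ray closed, dn ∉ C(0)]`
(`screening_mul_real_le_pinchScreen`). References: Aizenman–Duminil-Copin 2021, Appendix A, Lemma A.1;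
Friedli–Velenik 2017, Exercise 3.12. -/

noncomputable section

namespace Summit.CriticalPhenomena.Ising3DConformalLimit.EnergyNotSigmaSquaredGapForcesFarMerging

open scoped symmDiff ENNReal
open MeasureTheory Filter Finset
open Literature.Probability.LatticeModels Literature.Probability.Percolation
open Summit.CriticalPhenomena.Ising3DConformalLimit.Theorems.GapForcesFarMerging.Negative (e₁ e₂ cc2 xR up dn)
open Summit.CriticalPhenomena.Ising3DConformalLimit.GapForcesFarMergingScreening

/-! ### Coordinates and box membership on `ℤ³` -/

/-- Box membership on `ℤ³`, coordinatewise. [folklore] -/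
theorem mem_box_three {n : ℕ} {x : Site 3} :
    x ∈ box 3 n ↔ (-(n : ℤ) ≤ x 0 ∧ x 0 ≤ n) ∧ (-(n : ℤ) ≤ x 1 ∧ x 1 ≤ n) ∧ (-(n : ℤ) ≤ x 2 ∧ x 2 ≤ n) := by
  rw [mem_box, Fin.forall_fin_succ, Fin.forall_fin_succ, Fin.forall_fin_one]
  rfl

/-- Coordinates of `e₂ = (0,1,0)`. [folklore] -/
theorem e₂_coords : (e₂ : Site 3) 0 = 0 ∧ (e₂ : Site 3) 1 = 1 ∧ (e₂ : Site 3) 2 = 0 := by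
  refine ⟨?_, ?_, ?_⟩ <;> simp

/-- Coordinates of `up m = (2m, m, 0)`. [folklore] -/
theorem up_coords (m : ℕ) : up m 0 = 2 * m ∧ up m 1 = m ∧ up m 2 = 0 := by
  refine ⟨?_, ?_, ?_⟩ <;> simp [up, xR]

/-- Coordinates of `dn m = (2m, -m, 0)`. [folklore] -/
theorem dn_coords (m : ℕ) : dn m 0 = 2 * m ∧ dn m 1 = -(m : ℤ) ∧ dn m 2 = 0 := by
  refine ⟨?_, ?_, ?_⟩ <;> simp [dn, xR]

/-- Coordinates of the ray points `(0,1,t)`. [folklore] -/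
theorem rayPt_coords (t : ℤ) :
    Function.update (e₂ : Site 3) 2 t 0 = 0 ∧ Function.update (e₂ : Site 3) 2 t 1 = 1 ∧
      Function.update (e₂ : Site 3) 2 t 2 = t := by
  refine ⟨?_, ?_, ?_⟩ <;> simp

/-- Coordinates of the points `(0,t,0)`. [folklore] -/
theorem axisPt_coords (s t : ℤ) :
    Function.update (Function.update (0 : Site 3) 1 s) 1 t 0 = 0 ∧
      Function.update (Function.update (0 : Site 3) 1 s) 1 t 1 = t ∧
      Function.update (Function.update (0 : Site 3) 1 s) 1 t 2 = 0 := by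
  refine ⟨?_, ?_, ?_⟩ <;> simp

/-- `|{a} ∆ {b}| = 2` for `a ≠ b`. [folklore] -/
theorem card_pair_symmDiff {a b : Site 3} (h : a ≠ b) : #({a} ∆ {b} : Finset (Site 3)) = 2 := by
  rw [show ({a} ∆ {b} : Finset (Site 3)) = {a, b} by
    ext y; simp [Finset.mem_symmDiff]; constructor
    · rintro (⟨h, -⟩ | ⟨h, -⟩) <;> simp [h]
    · rintro (h' | h') <;> subst h' <;> simp [h, Ne.symm h]]
  exact Finset.card_pair h

/-- A pair `{a} ∆ {b}` lies in a set containing `a` and `b`. [folklore] -/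
theorem pair_symmDiff_subset {a b : Site 3} {s : Finset (Site 3)} (ha : a ∈ s) (hb : b ∈ s) :
    ({a} ∆ {b} : Finset (Site 3)) ⊆ s := fun x hx => by
  rcases Finset.mem_symmDiff.1 hx with ⟨h, -⟩ | ⟨h, -⟩
  · rw [Finset.mem_singleton.1 h]; exact ha
  · rw [Finset.mem_singleton.1 h]; exact hb

/-! ### The mean screening as a series over pairs of currents -/

/-- **The mean screening is a series**: `meanScreening n r o x a b = ∑_p P^{{o}∆{x},∅}_{Λ_n}(p) ·
screenWeight(trace p)` over pairs of currents of the free box graph (the box law is the push-forward of a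
normalised sum of Dirac masses). [cite: AizenmanDuminilCopinAnnals2021, §3.1] -/
theorem meanScreening_eq_tsum (n r : ℕ) (o x a b : Site 3) :
    meanScreening n r o x a b =
      ∑' p : Current (freeBoxGraph 3 n) × Current (freeBoxGraph 3 n),
        pairWeight (freeBoxGraph 3 n) (criticalBeta 3) (boxSources 3 n ({o} ∆ {x})) ∅ p /
            (currentSum (freeBoxGraph 3 n) (criticalBeta 3) (boxSources 3 n ({o} ∆ {x})) *
              currentSum (freeBoxGraph 3 n) (criticalBeta 3) ∅) *
          screenWeight n r o a b (sourcedTrace 3 n p) := by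
  have hβ : 0 ≤ criticalBeta 3 := criticalBeta_nonneg 3
  unfold meanScreening sourcedDoubleCurrentLaw doubleCurrentMeasure
  rw [boxSources_empty, Measure.map_sum (measurable_sourcedTrace n).aemeasurable]
  simp_rw [Measure.map_smul, Measure.map_dirac' (measurable_sourcedTrace n)]
  rw [integral_sum_dirac (fun _ => ENNReal.ofReal_ne_top)]
  refine tsum_congr fun p => ?_
  rw [ENNReal.toReal_ofReal (div_nonneg (pairWeight_nonneg _ hβ _ _ p)
    (mul_nonneg (currentSum_nonneg _ hβ _) (currentSum_nonneg _ hβ _))), smul_eq_mul]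

/-! ### Pointwise bounds on the screening functional -/

/-- A site all of whose pairs are closed is not in the open cluster of another site. [folklore] -/
theorem not_mem_openCluster_of_closed {ω : BondConfig (Site 3)} {x o : Site 3} (hxo : x ≠ o)
    (hiso : ∀ z : Site 3, s(x, z) ∉ ω) : x ∉ openCluster ω o := by
  intro hx
  change (openGraph ω).Reachable o x at hx
  obtain ⟨p⟩ := hx.symm
  cases p with
  | nil => exact hxo rfl
  | cons h _ =>
    rw [openGraph_adj] at h
    exact hiso _ h.1

/-- The explored cluster of `o` lies in the full cluster of `o`. [folklore] -/
theorem innerCluster_subset_openCluster (r : ℕ) (o : Site 3) (ω : BondConfig (Site 3)) :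
    ∀ v ∈ innerCluster r o ω, v ∈ openCluster ω o := fun v hv => by
  classical
  unfold innerCluster at hv
  exact openClusterIn_subset_openCluster _ ω o (Finset.mem_filter.1 hv).2

/-- The explored cluster lies in `Λ_r`. [folklore] -/
theorem innerCluster_subset_box (r : ℕ) (o : Site 3) (ω : BondConfig (Site 3)) :
    innerCluster r o ω ⊆ box 3 r := by
  classical
  unfold innerCluster
  exact Finset.filter_subset _ _

/-- **`0 ≤ screenWeight ≤ 1`** once the probe points lie in the box (Griffiths I, and volume monotonicity
for the numerator region `Λ_n ∖ C_r ⊆ Λ_n`). [cite: FriedliVelenik2017, Exercise 3.12] -/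
theorem screenWeight_mem_Icc {n r m : ℕ} (he : (e₂ : Site 3) ∈ box 3 n) (hd : dn m ∈ box 3 n)
    (ω : BondConfig (Site 3)) : screenWeight n r 0 e₂ (dn m) ω ∈ Set.Icc (0 : ℝ) 1 := by
  have hβ : 0 < criticalBeta 3 := criticalBeta_pos_holds (d := 3) (by norm_num)
  unfold screenWeight
  split_ifs with h
  · exact ⟨le_rfl, zero_le_one⟩
  · push Not at h
    have heT : (e₂ : Site 3) ∈ box 3 n \ innerCluster r 0 ω :=
      Finset.mem_sdiff.2 ⟨he, fun h' => h.1 (innerCluster_subset_openCluster r 0 ω _ h')⟩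
    have hdT : dn m ∈ box 3 n \ innerCluster r 0 ω :=
      Finset.mem_sdiff.2 ⟨hd, fun h' => h.2 (innerCluster_subset_openCluster r 0 ω _ h')⟩
    unfold screening boxTwoPoint
    rw [isingTwoPoint_free_eq_isingCorr_symmDiff, isingTwoPoint_free_eq_isingCorr_symmDiff,
      Finset.sdiff_empty]
    have hnum0 : 0 ≤ isingCorr (zdGraph 3) (box 3 n \ innerCluster r 0 ω) (criticalBeta 3) 0 .free
        ({e₂} ∆ {dn m}) :=
      GKSInequalities.gks_one_holds _ hβ.le le_rfl (Or.inl rfl) (pair_symmDiff_subset heT hdT)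
    have hden0 : 0 ≤ isingCorr (zdGraph 3) (box 3 n) (criticalBeta 3) 0 .free ({e₂} ∆ {dn m}) :=
      GKSInequalities.gks_one_holds _ hβ.le le_rfl (Or.inl rfl) (pair_symmDiff_subset he hd)
    refine ⟨div_nonneg hnum0 hden0, div_le_one_of_le₀ ?_ hden0⟩
    exact isingCorr_free_le_of_subset _ hβ.le le_rfl (pair_symmDiff_subset heT hdT) Finset.sdiff_subset

/-- **On the ray event the screening functional dominates the root obstacle ratio**: if every pair
through a site of `R = {(0,1,t) : 0 ≤ t ≤ r}` is closed and `dn m ∉ C(0)`, then `e₂ ∉ C(0)`, the explored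
cluster `C_r(0)` lies in `T₀ = Λ_r ∖ R`, and `screenWeight ≥ S_{e₂,dn m}(T₀)` (antitonicity of the
restricted two-point function in the deleted set). [cite: AizenmanDuminilCopinAnnals2021, Appendix A, Lemma A.1] -/
theorem screening_le_screenWeight {n r m : ℕ} (hr : 1 ≤ r) (hm : r < m) (hn : 2 * m ≤ n)
    {ω : BondConfig (Site 3)}
    (hray : ∀ x ∈ (box 3 r).filter (fun x : Site 3 => x 0 = 0 ∧ x 1 = 1 ∧ 0 ≤ x 2), ∀ z : Site 3, s(x, z) ∉ ω)
    (hdn : dn m ∉ openCluster ω 0) :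
    screening n ((box 3 r).filter fun x : Site 3 => ¬(x 0 = 0 ∧ x 1 = 1 ∧ 0 ≤ x 2)) e₂ (dn m) ≤
      screenWeight n r 0 e₂ (dn m) ω := by
  have hβ : 0 < criticalBeta 3 := criticalBeta_pos_holds (d := 3) (by norm_num)
  obtain ⟨he0, he1, he2⟩ := e₂_coords
  obtain ⟨hd0, hd1, hd2⟩ := dn_coords m
  have he₂R : (e₂ : Site 3) ∈ (box 3 r).filter (fun x : Site 3 => x 0 = 0 ∧ x 1 = 1 ∧ 0 ≤ x 2) := by
    rw [Finset.mem_filter, mem_box_three, he0, he1, he2]; omega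
  have hnotC : ∀ x ∈ (box 3 r).filter (fun x : Site 3 => x 0 = 0 ∧ x 1 = 1 ∧ 0 ≤ x 2), x ∉ openCluster ω 0 :=
    fun x hx => not_mem_openCluster_of_closed (fun h => by
      have h1 := (Finset.mem_filter.1 hx).2.2.1; rw [h] at h1; simp at h1) (hray x hx)
  have he₂C : (e₂ : Site 3) ∉ openCluster ω 0 := hnotC _ he₂R
  unfold screenWeight
  rw [if_neg (not_or.2 ⟨he₂C, hdn⟩)]
  -- the explored cluster misses the ray
  have hsub : innerCluster r 0 ω ⊆ (box 3 r).filter fun x : Site 3 => ¬(x 0 = 0 ∧ x 1 = 1 ∧ 0 ≤ x 2) := by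
    intro v hv
    have hvr : v ∈ box 3 r := innerCluster_subset_box r 0 ω hv
    refine Finset.mem_filter.2 ⟨hvr, fun hvray => ?_⟩
    exact hnotC v (Finset.mem_filter.2 ⟨hvr, hvray⟩) (innerCluster_subset_openCluster r 0 ω v hv)
  have he₂n : (e₂ : Site 3) ∈ box 3 n := by rw [mem_box_three, he0, he1, he2]; omega
  have hdnn : dn m ∈ box 3 n := by rw [mem_box_three, hd0, hd1, hd2]; omega
  have he₂T : (e₂ : Site 3) ∈ box 3 n \ (box 3 r).filter fun x : Site 3 => ¬(x 0 = 0 ∧ x 1 = 1 ∧ 0 ≤ x 2) :=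
    Finset.mem_sdiff.2 ⟨he₂n, fun h => (Finset.mem_filter.1 h).2 (Finset.mem_filter.1 he₂R).2⟩
  have hdnT : dn m ∈ box 3 n \ (box 3 r).filter fun x : Site 3 => ¬(x 0 = 0 ∧ x 1 = 1 ∧ 0 ≤ x 2) :=
    Finset.mem_sdiff.2 ⟨hdnn, fun h => by
      have := (Finset.mem_filter.1 h).1; rw [mem_box_three, hd0] at this; omega⟩
  unfold screening boxTwoPoint
  rw [isingTwoPoint_free_eq_isingCorr_symmDiff, isingTwoPoint_free_eq_isingCorr_symmDiff,
    isingTwoPoint_free_eq_isingCorr_symmDiff, Finset.sdiff_empty]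
  refine div_le_div_of_nonneg_right ?_
    (GKSInequalities.gks_one_holds _ hβ.le le_rfl (Or.inl rfl) (pair_symmDiff_subset he₂n hdnn))
  exact isingCorr_free_le_of_subset _ hβ.le le_rfl (pair_symmDiff_subset he₂T hdnT)
    (Finset.sdiff_subset_sdiff le_rfl hsub)

/-! ### The root ladder dominates the obstacle ratio times the probability of the ray event -/

/-- **`pinchScreen n r m ≥ S_{e₂ dn}(Λ_r ∖ R) · P^{0 up,∅}_{Λ_n}[all pairs at R closed, dn m ∉ C(0)]`**
(`r ≥ 1`, `m > r`, `n ≥ 2m`; the probability written on pairs of box currents). [cite: AizenmanDuminilCopinAnnals2021, Appendix A, Lemma A.1] -/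
theorem screening_mul_real_le_pinchScreen {n r m : ℕ} (hr : 1 ≤ r) (hm : r < m) (hn : 2 * m ≤ n) :
    screening n ((box 3 r).filter fun x : Site 3 => ¬(x 0 = 0 ∧ x 1 = 1 ∧ 0 ≤ x 2)) e₂ (dn m) *
        (doubleCurrentMeasure (freeBoxGraph 3 n) (criticalBeta 3) (boxSources 3 n ({0} ∆ {up m})) ∅).real
          {p | (∀ x ∈ (box 3 r).filter (fun x : Site 3 => x 0 = 0 ∧ x 1 = 1 ∧ 0 ≤ x 2), ∀ z : Site 3,
              s(x, z) ∉ sourcedTrace 3 n p) ∧ dn m ∉ openCluster (sourcedTrace 3 n p) 0} ≤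
      pinchScreen n r m := by
  classical
  have hβ : 0 < criticalBeta 3 := criticalBeta_pos_holds (d := 3) (by norm_num)
  obtain ⟨he0, he1, he2⟩ := e₂_coords
  obtain ⟨hd0, hd1, hd2⟩ := dn_coords m
  obtain ⟨hu0, hu1, hu2⟩ := up_coords m
  have he₂n : (e₂ : Site 3) ∈ box 3 n := by rw [mem_box_three, he0, he1, he2]; omega
  have hdnn : dn m ∈ box 3 n := by rw [mem_box_three, hd0, hd1, hd2]; omega
  have hupn : up m ∈ box 3 n := by rw [mem_box_three, hu0, hu1, hu2]; omega
  set G := freeBoxGraph 3 n with hG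
  set A' := boxSources 3 n (({0} : Finset (Site 3)) ∆ {up m}) with hA'
  set E : Set (Current G × Current G) := {p | (∀ x ∈ (box 3 r).filter
      (fun x : Site 3 => x 0 = 0 ∧ x 1 = 1 ∧ 0 ≤ x 2), ∀ z : Site 3, s(x, z) ∉ sourcedTrace 3 n p) ∧
      dn m ∉ openCluster (sourcedTrace 3 n p) 0} with hE
  set s := screening n ((box 3 r).filter fun x : Site 3 => ¬(x 0 = 0 ∧ x 1 = 1 ∧ 0 ≤ x 2)) e₂ (dn m) with hs
  set Z := currentSum G (criticalBeta 3) A' * currentSum G (criticalBeta 3) ∅ with hZ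
  have hne : (0 : Site 3) ≠ up m := fun h => by have := congr_fun h 0; rw [hu0] at this; simp at this; omega
  have hZpos : 0 < Z := mul_pos (currentSum_boxSources_pos 3 hβ (symmDiff_singleton_subset_box 3 (zero_mem_box 3 n) hupn)
    (by rw [card_pair_symmDiff hne]; exact even_two)) (currentSum_empty_pos' G _)
  -- the probability as a series
  have hreal : (doubleCurrentMeasure G (criticalBeta 3) A' ∅).real E =
      ∑' p, pairWeight G (criticalBeta 3) A' ∅ p / Z * E.indicator 1 p := by
    have h := doubleCurrentMeasure_real_mul' G hβ.le A' ∅ (E := E) (Set.to_countable _).measurableSet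
    rw [← hZ] at h
    rw [(eq_div_iff hZpos.ne').2 h, ← tsum_div_const]
    exact tsum_congr fun p => by ring
  -- termwise comparison
  rw [pinchScreen, meanScreening_eq_tsum, hreal, ← tsum_mul_left]
  have hbd : ∀ p : Current G × Current G, ‖E.indicator (1 : Current G × Current G → ℝ) p‖ ≤ 1 := fun p => by
    rw [Set.indicator_apply]; split_ifs <;> simp
  have hbd' : ∀ p : Current G × Current G, ‖screenWeight n r 0 e₂ (dn m) (sourcedTrace 3 n p)‖ ≤ 1 := fun p => by
    obtain ⟨h0, h1⟩ := screenWeight_mem_Icc (r := r) he₂n hdnn (sourcedTrace 3 n p)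
    rw [Real.norm_eq_abs, abs_of_nonneg h0]; exact h1
  refine Summable.tsum_le_tsum (fun p => ?_) ?_ ?_
  · rw [Set.indicator_apply]
    split_ifs with hp
    · rw [Pi.one_apply, mul_one, mul_comm]
      exact mul_le_mul_of_nonneg_left (screening_le_screenWeight hr hm hn hp.1 hp.2)
        (div_nonneg (pairWeight_nonneg _ hβ.le _ _ p) hZpos.le)
    · rw [mul_zero, mul_zero]
      exact mul_nonneg (div_nonneg (pairWeight_nonneg _ hβ.le _ _ p) hZpos.le)
        (screenWeight_mem_Icc (r := r) he₂n hdnn _).1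
  · have h := (summable_pairWeight_mul G (criticalBeta 3) A' ∅ hbd).div_const Z |>.mul_left s
    refine h.congr fun p => ?_
    ring
  · have h := (summable_pairWeight_mul G (criticalBeta 3) A' ∅ hbd').div_const Z
    refine h.congr fun p => ?_
    ring

/-- **The mean screening is a series** (registered form of `meanScreening_eq_tsum`). [cite: AizenmanDuminilCopinAnnals2021, §3.1] -/
theorem meanScreening_series : ∀ (n r : ℕ) (o x a b : Site 3), meanScreening n r o x a b = ∑' p : Current (freeBoxGraph 3 n) × Current (freeBoxGraph 3 n), pairWeight (freeBoxGraph 3 n) (criticalBeta 3) (boxSources 3 n ({o} ∆ {x})) ∅ p / (currentSum (freeBoxGraph 3 n) (criticalBeta 3) (boxSources 3 n ({o} ∆ {x})) * currentSum (freeBoxGraph 3 n) (criticalBeta 3) ∅) * screenWeight n r o a b (sourcedTrace 3 n p) :=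
  meanScreening_eq_tsum

end Summit.CriticalPhenomena.Ising3DConformalLimit.EnergyNotSigmaSquaredGapForcesFarMerging

end
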